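import Literature.AlgebraicGeometry.Frobenioids.MotivatingExamplesThm64ivFieldIso
import HarnessLib

/-!
# Frobenioids I, Theorem 6.4 (iv): "`deg(Ψ^rlf) = 1`" and "`L₂ ≅ L₁`" from the transported data — the
# number-field core of the composition (sub-DAG rows T64iv/L05 + L07a assembled; input of row T64iv/L08)

Mochizuki, *The geometry of Frobenioids I: the general theory*, Kyushu J. Math. **62** (2008) 293–400, §6,
Thm. 6.4 (iv) p. 115 l. 17–29, proof p. 116 l. 17–35 [cite: MochizukiFrdI2008, Thm. 6.4 (iv) p.116]:

> "Thus, it follows that if `v₁`, `v₂` lie over a prime `p ∈ Primes` [cf. assertion (iii)], then [again by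
> assertion (iii)] `p` splits completely in `L₁` if and only if `p` splits completely in `L₂`. If this is the
> case, then it follows that `deg^arith_{L_i}` maps a generator of the monoid `Φ_i(L_i)_{v_i} (≅ ℤ_{≥0})` to
> `log(p)`. Thus, we conclude that `deg(Φ^rlf) = 1`, as desired. … hence that `L₁ = L₂`."

PROOF-ONLY file (cell abc-iut, `plan/L1/SUBDAG-FrdI-Thm64.md` §G, the DATA-LEVEL CORE of the composition row
**T64iv/L08**; L1-lead R108 (4) row (G); seat abc-iut-L1-d7).  INPUT SHAPE = exactly what the three transport
rows deliver for an equivalence `Ψ : C₁ ⥲ C₂` of arithmetic Frobenioids at `X = Spec L₁`, `L₂ :=` the field of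
`Ψ^Base X`:  a bijection of finite places `π : V(L₁)^non ≃ V(L₂)^non` with `Ψ^Φ_X(δ_w) = δ_{π w}` (row T64iv/L01,
`ArithmeticFrobenioidThm64ivTransport.lean`, this seat), preserving residue characteristics (Thm. 6.4 (iii), row
(F)), and the degree `deg = deg(Ψ^rlf) > 0` of Thm. 6.4 (ii) READ AT GENERATORS — `deg · log N(w) = log N(π w)`
(rows (E) + T64i/L15: `δ_A` of the generator class at `w` is `log N(w)`).  OUTPUT: `deg = 1` (first clause of
(iv): a completely split prime of `L₁` — T64iv/L03, Chebotarev — stays completely split in `L₂` — T64iv/L04 —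
and its places have norm `p` on both sides, so T64iv/L05 applies) and, for `L₁` Galois over `ℚ`, `L₁ ≅ L₂`
(T64iv/L07a, abc-iut-w4-d109's `nonempty_ringEquiv_of_isGalois_of_logNorm_transport`).  The compatibility with an
isomorphism `F₁ ≅ F₂` (T64iv/L07b) is GAP-LEDGER G-L1t3-1 (reduction: abc-iut-L1-d4) and is not claimed.
No definitions, no named facts; classical algebraic number theory over abc-iut-L1-t1's sub-DAG vocabulary
(`residueChar`, `logNorm`, `placesOver`, `SplitsCompletely`); nothing here bears on [IUTchIII] Cor. 3.12.
-/

noncomputable section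

namespace Literature.AlgebraicGeometry.Frobenioids

open CategoryTheory NumberField IsDedekindDomain Ideal

/-! ### At a completely split prime every place has norm `p` -/

section Split

variable {L : Type} [Field L] [NumberField L]

/-- "`p_i` splits completely in `L_i` … then `deg^arith_{L_i}` maps a generator of `Φ_i(L_i)_{v_i}` to `log(p)`"
(p. 116 l. 25–27): above a completely split rational prime `p`, every finite place of residue characteristic
`p` has absolute norm `p` (residue degree one). [cite: MochizukiFrdI2008, Thm. 6.4 (iv) p.116] -/
theorem absNorm_eq_of_splitsCompletely {p : ℕ} (hs : SplitsCompletely L p) (w : FinitePlace L)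
    (hw : residueChar w = p) : absNorm w.maximalIdeal.asIdeal = p := by
  obtain ⟨hp, -, hall⟩ := (splitsCompletely_iff_prime_and p).mp hs
  have hlo := liesOver_residueChar w
  rw [hw] at hlo
  have hmem : ((p : ℕ) : 𝓞 L) ∈ w.maximalIdeal.asIdeal := by
    have h : (p : ℤ) ∈ (span {(p : ℤ)} : Ideal ℤ) := mem_span_singleton_self _
    rw [hlo.over, mem_comap] at h
    simpa using h
  exact hall w.maximalIdeal hmem

/-- Hence `log N(w) = log p` there. [cite: MochizukiFrdI2008, Thm. 6.4 (iv) p.116] -/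
theorem logNorm_eq_log_of_splitsCompletely {p : ℕ} (hs : SplitsCompletely L p) (w : FinitePlace L)
    (hw : residueChar w = p) : logNorm w = Real.log p := by
  simp only [logNorm, absNorm_eq_of_splitsCompletely hs w hw]

end Split

/-! ### `deg(Ψ^rlf) = 1` and `L₁ ≅ L₂` from the transported data -/

section Core

variable (L₁ : Type) [Field L₁] [NumberField L₁] (L₂ : Type) [Field L₂] [NumberField L₂]

/-- **Thm. 6.4 (iv), first clause — "`deg(Ψ^rlf) = 1`"** (proof p. 116 l. 17–27), from the transported data:
a residue-characteristic preserving bijection `π` of finite places (Thm. 6.4 (iii)) along which the degree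
relation of Thm. 6.4 (ii) reads, at generators, `deg · log N(w) = log N(π w)` with `deg > 0`.  A completely split
prime `p` of `L₁` exists (T64iv/L03) and is completely split in `L₂` (T64iv/L04); at places `v₁ ↦ π v₁` above
it both norms are `p` (T64iv/L02), so `deg · log p = log p` and `deg = 1` (T64iv/L05).
[cite: MochizukiFrdI2008, Thm. 6.4 (iv) p.116] -/
theorem Thm64iv_degOne_of_transport (π : FinitePlace L₁ ≃ FinitePlace L₂)
    (hπ : ∀ w, residueChar (π w) = residueChar w) (deg : ℝ)
    (hgen : ∀ w, deg * logNorm w = logNorm (π w)) : deg = 1 := by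
  obtain ⟨p, hsplit⟩ := Thm64iv_L03_existsSplitPrime_holds L₁
  have hp : p.Prime := hsplit.1
  have hsplit₂ : SplitsCompletely L₂ p := ((Thm64iv_L04_degreeEq_holds L₁ L₂ π hπ).2.2 p).mp hsplit
  obtain ⟨v₁, hv₁⟩ := exists_residueChar_eq (L := L₁) hp
  have hN₁ : absNorm v₁.maximalIdeal.asIdeal = p := absNorm_eq_of_splitsCompletely hsplit v₁ hv₁
  have hN₂ : absNorm (π v₁).maximalIdeal.asIdeal = p :=
    absNorm_eq_of_splitsCompletely hsplit₂ (π v₁) ((hπ v₁).trans hv₁)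
  exact Thm64iv_L05_degOne_holds L₁ L₂ deg v₁ (π v₁) (hN₁ ▸ hp) (hN₁.trans hN₂.symm) (hgen v₁)

/-- **Thm. 6.4 (iv) from the transported data — both clauses its printed proof establishes**: `deg(Ψ^rlf) = 1`,
and if `L₁` is Galois over `ℚ` then `L₁ ≅ L₂` (T64iv/L07a: with `deg = 1` the relation at generators says
`log N(w) = log N(π w)`, so degree-one places correspond, every unramified prime below a degree-one place of
`L₂` splits completely in the Galois `L₁`, Bauer's theorem gives `L₁ ↪ L₂`, and the degrees agree).  The
compatibility with an isomorphism `F₁ ≅ F₂` asserted in print (row T64iv/L07b) is not argued in the printed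
proof and not claimed here. [cite: MochizukiFrdI2008, Thm. 6.4 (iv) p.116] -/
theorem Thm64iv_of_transport (π : FinitePlace L₁ ≃ FinitePlace L₂)
    (hπ : ∀ w, residueChar (π w) = residueChar w) (deg : ℝ)
    (hgen : ∀ w, deg * logNorm w = logNorm (π w)) :
    deg = 1 ∧ (IsGalois ℚ L₁ → Nonempty (L₁ ≃+* L₂)) := by
  have hdeg : deg = 1 := Thm64iv_degOne_of_transport L₁ L₂ π hπ deg hgen
  refine ⟨hdeg, fun hgal => ?_⟩
  haveI := hgal
  exact nonempty_ringEquiv_of_isGalois_of_logNorm_transport L₁ L₂ π hπ fun w => by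
    rw [← hgen w, hdeg, one_mul]

/-- The same with the degree relation the other way round (`log N(π w) = deg · log N(w)`, the letter of
abc-iut-L1-t3's `Thm64iiDeg`: `δ_{A₂} ∘ picMap = deg · δ_{A₁}`). [cite: MochizukiFrdI2008, Thm. 6.4 (iv) p.116] -/
theorem Thm64iv_of_transport' (π : FinitePlace L₁ ≃ FinitePlace L₂)
    (hπ : ∀ w, residueChar (π w) = residueChar w) (deg : ℝ)
    (hgen : ∀ w, logNorm (π w) = deg * logNorm w) :
    deg = 1 ∧ (IsGalois ℚ L₁ → Nonempty (L₁ ≃+* L₂)) :=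
  Thm64iv_of_transport L₁ L₂ π hπ deg fun w => (hgen w).symm

end Core

/-! ### In the letter of the schema `Thm64iv`: at `X : D₁` with `Ψ^Base : D₁ ⥤ D₂` -/

section Schema

variable {F₁ : Type} [Field F₁] [NumberField F₁] {K₁ : Type} [Field K₁] [Algebra F₁ K₁]
variable {F₂ : Type} [Field F₂] [NumberField F₂] {K₂ : Type} [Field K₂] [Algebra F₂ K₂]

/-- **Thm. 6.4 (iv) at an object `X = Spec L₁` of `D₁`, from the transports** (the conclusion shape of
abc-iut-L1-t3's schema `Thm64iv` minus its T64iv/L07b conjunct): for `Ψ^Base : D₁ ⥤ D₂` (Cor. 4.11 (ii)), a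
bijection `π` between the finite places of `L₁` and of the field `L₂` of `Ψ^Base X` carrying generator to generator
(T64iv/L01) and preserving residue characteristics (Thm. 6.4 (iii)), and the degree `deg` of Thm. 6.4 (ii) read at
generators, `deg = 1` and — if `L₁` is Galois over `ℚ` — `L₁ ≅ L₂`. [cite: MochizukiFrdI2008, Thm. 6.4 (iv) p.115] -/
theorem Thm64iv_at_of_transport (ΨBase : FinSubextCat F₁ K₁ ⥤ FinSubextCat F₂ K₂) (X : FinSubextCat F₁ K₁)
    (π : FinitePlace X.L ≃ FinitePlace (ΨBase.obj X).L) (hπ : ∀ w, residueChar (π w) = residueChar w)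
    (deg : ℝ) (hgen : ∀ w, logNorm (π w) = deg * logNorm w) :
    deg = 1 ∧ (IsGalois ℚ X.L → Nonempty (X.L ≃+* (ΨBase.obj X).L)) :=
  Thm64iv_of_transport' X.L (ΨBase.obj X).L π hπ deg hgen

end Schema

/-! ### v2: the residue characteristics come for free — an INTEGRAL degree relation is the `q = 1` case of (iii) -/

section Integral

variable (L₁ : Type) [Field L₁] [NumberField L₁] (L₂ : Type) [Field L₂] [NumberField L₂]

/-- **Thm. 6.4 (iii) at `q = 1`** ("assertion (iii) follows formally from assertion (ii), by applying Lemma 6.5",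
p. 116 l. 4–16): if along a bijection `π` of finite places the degree relation holds AT GENERATORS with a real
`deg > 0` — `deg · log N(w) = log N(π w)` for every `w`, the situation of an equivalence `Ψ` of the Frobenioids
THEMSELVES (generator ↦ generator, T64iv/L01) — then `π` preserves residue characteristics: abc-iut-L1-t1's
numeric core T64iii/L06 (`Thm64iii_L06_degRational_holds`: Lang's transcendence result via Lem. 6.5 (ii), then
Lem. 6.5 (i)) with all rational factors `q_w = 1`. So for Thm. 6.4 (iv) the place bijection of (iii) need not be
imported separately. [cite: MochizukiFrdI2008, Thm. 6.4 (iii) p.116] -/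
theorem residueChar_eq_of_logNorm_transport (π : FinitePlace L₁ ≃ FinitePlace L₂) (deg : ℝ) (hdeg : 0 < deg)
    (hgen : ∀ w, deg * logNorm w = logNorm (π w)) (w : FinitePlace L₁) : residueChar (π w) = residueChar w :=
  (Thm64iii_L06_degRational_holds L₁ L₂ deg π hdeg fun w' => ⟨1, one_pos, by rw [hgen w', Rat.cast_one, one_mul]⟩).2 w

/-- **Thm. 6.4 (iv) from the INTEGRAL degree relation alone**: a bijection `π` of finite places and a real
`deg > 0` with `deg · log N(w) = log N(π w)` for all `w` force `deg = 1`, and `L₁ ≅ L₂` if `L₁` is Galois over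
`ℚ` (residue characteristics by `residueChar_eq_of_logNorm_transport`, then `Thm64iv_of_transport`).
[cite: MochizukiFrdI2008, Thm. 6.4 (iv) p.116] -/
theorem Thm64iv_of_logNorm_transport (π : FinitePlace L₁ ≃ FinitePlace L₂) (deg : ℝ) (hdeg : 0 < deg)
    (hgen : ∀ w, deg * logNorm w = logNorm (π w)) :
    deg = 1 ∧ (IsGalois ℚ L₁ → Nonempty (L₁ ≃+* L₂)) :=
  Thm64iv_of_transport L₁ L₂ π (residueChar_eq_of_logNorm_transport L₁ L₂ π deg hdeg hgen) deg hgen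

/-- The same in the letter of abc-iut-L1-t3's `Thm64iiDeg` (`log N(π w) = deg · log N(w)`).
[cite: MochizukiFrdI2008, Thm. 6.4 (iv) p.116] -/
theorem Thm64iv_of_logNorm_transport' (π : FinitePlace L₁ ≃ FinitePlace L₂) (deg : ℝ) (hdeg : 0 < deg)
    (hgen : ∀ w, logNorm (π w) = deg * logNorm w) :
    deg = 1 ∧ (IsGalois ℚ L₁ → Nonempty (L₁ ≃+* L₂)) :=
  Thm64iv_of_logNorm_transport L₁ L₂ π deg hdeg fun w => (hgen w).symm

end Integral

section SchemaIntegral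

variable {F₁ : Type} [Field F₁] [NumberField F₁] {K₁ : Type} [Field K₁] [Algebra F₁ K₁]
variable {F₂ : Type} [Field F₂] [NumberField F₂] {K₂ : Type} [Field K₂] [Algebra F₂ K₂]

/-- **Thm. 6.4 (iv) at `X = Spec L₁ ∈ Ob(D₁)`, from `Ψ^Base`, the generator-to-generator bijection `π` of
T64iv/L01 and the degree `deg > 0` of Thm. 6.4 (ii) read at generators** — no separate (iii)-input: `deg = 1`,
and `L₁ ≅ L₂ := (Ψ^Base X).L` if `L₁` is Galois over `ℚ` (T64iv/L07b not claimed).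
[cite: MochizukiFrdI2008, Thm. 6.4 (iv) p.115] -/
theorem Thm64iv_at_of_logNorm_transport (ΨBase : FinSubextCat F₁ K₁ ⥤ FinSubextCat F₂ K₂)
    (X : FinSubextCat F₁ K₁) (π : FinitePlace X.L ≃ FinitePlace (ΨBase.obj X).L) (deg : ℝ) (hdeg : 0 < deg)
    (hgen : ∀ w, logNorm (π w) = deg * logNorm w) :
    deg = 1 ∧ (IsGalois ℚ X.L → Nonempty (X.L ≃+* (ΨBase.obj X).L)) :=
  Thm64iv_of_logNorm_transport' X.L (ΨBase.obj X).L π deg hdeg hgen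

end SchemaIntegral

end Literature.AlgebraicGeometry.Frobenioids

end
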